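import Literature.NumberTheory.Automorphic.FontaineMazurGL2OddPrimeTateTwist
import Literature.NumberTheory.Automorphic.CompletedCohomologyHeckeAlgebraGLn
import Literature.NumberTheory.GaloisRepresentations.LabelledWeightsTateTwist
import Literature.NumberTheory.GaloisRepresentations.LabelledWeightsDeRhamRank
import Literature.NumberTheory.GaloisRepresentations.TateTwistFrobeniusProofs
import HarnessLib

/-!
# Classicality of pro-modular regular de Rham representations of `Γ_ℚ` at EVERY prime `p`
# (Pan, arXiv:2209.06366, Thm. 1.1.2 = Thm. 7.1.2; with Pan, Forum Math. Pi 10 (2022),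
# Def. 6.1.2 and Cor. 6.3.6, and Paškūnas–Tung 2021, Thm. 7.1)

Topic `Literature/NumberTheory/Automorphic`; companion of `FontaineMazurGL2OddPrimeTateTwist`
(whose named fact `XZhang2024_fontaineMazurGL2_tateTwist` is the Fontaine–Mazur theorem for
`GL₂/ℚ` at every ODD prime, with the same conclusion shape as below) and of
`CompletedCohomologyHeckeAlgebraGLn` (whose `BigHeckeGLn.TameLevel.IsPadicallyAutomorphic` types
"pro-modular").  ONE named fact (D-0014), `Pan2022_proModularDeRhamClassical_GL2Q`: for ANY prime
`p` — in particular `p = 2` — a continuous `ρ : Γ_ℚ → GL₂(ℚ̄_p)` which is residually absolutely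
irreducible, de Rham at `p` with distinct Hodge–Tate weights, and `p`-ADICALLY AUTOMORPHIC (a
continuous `ℚ̄_p`-point of the completed-cohomology Hecke algebra of `GL₂/ℚ` of some tame level)
is, up to a Tate twist, the Galois representation of a newform.  Consumer: crux
`DyadicOddResidue.DyadicDihedralFM` (item stmt-Langlands-18742), line `Sketch`, stub
`stub_classicality` — the half "pro-modular ⟹ classical" of the Fontaine–Mazur conjecture at
`ℓ = 2`; the other half (pro-modularity at `2` of a given `ρ`) is the OPEN core of that crux and is
a HYPOTHESIS here, never asserted.

## The printed theorems (held texts, quoted)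

* L. Pan, *On locally analytic vectors of the completed cohomology of modular curves II*,
  arXiv:2209.06366 (2022) [Pan2022LocallyAnalyticII].  §1.1.1 (p. 2): "Fix a prime number `p`
  throughout this paper. Let `K^p = ∏_{l≠p} K_l` be an open compact subgroup of `GL₂(𝔸^p_f)`. …
  `H̃^i(K^p, ℤ_p) := lim_n colim_{K_p ⊆ GL₂(ℚ_p)} H^i(Y_{K^pK_p}(ℂ), ℤ/p^n)`" (§7.1.1, p. 115, uses
  the complete curves `X_{K^pK_p}`; for the absolutely irreducible `ρ` below the two spaces
  `Hom_{G_ℚ}(ρ, H̃¹ ⊗ E)` coincide, the cokernel of `H¹(X) ↪ H¹(Y)` being the Eisenstein module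
  of the cusps).  **Theorem 1.1.2 (= Theorem 7.1.2, p. 116)**: "Let `E` be a finite extension of
  `ℚ_p` and `ρ : G_ℚ → GL₂(E)` be a two-dimensional continuous absolutely irreducible
  representation of `G_ℚ`. … Suppose that (1) `ρ` appears in
  `H̃¹(K^p, E) := H̃¹(K^p, ℤ_p) ⊗_{ℤ_p} E`, i.e. `Hom_{E[G_ℚ]}(ρ, H̃¹(K^p, E)) ≠ 0`.
  (2) `ρ|_{G_{ℚ_p}}` is de Rham of Hodge–Tate weights `0, k` for some integer `k > 0` … Then `ρ`
  arises from a cuspidal eigenform of weight `k + 1`."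
  §7.1.4 (pp. 116–117): `𝕋(K^pK_p) ⊆ End_{ℤ_p}(H¹(X_{K^pK_p}(ℂ), ℤ_p))` "the `ℤ_p`-subalgebra
  generated by Hecke operators `T_l, S_l^{±1}`, `l ∉ S`", `𝕋(K^p) := lim_{K_p} 𝕋(K^pK_p)`, "a
  complete semi-local noetherian `ℤ_p`-algebra", with Chenevier's determinant `D_S` of `G_{ℚ,S}`
  "such that the characteristic polynomial of `D_S(Frob_l)` is `X² - l⁻¹T_l X + l⁻¹S_l`. Its twist
  by the inverse of the cyclotomic character is also the Eichler–Shimura congruence relation, i.e.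
  `Frob_l² - T_l Frob_l + lS_l = 0` on `H̃¹(K^p, ℤ_p)`", and for `λ : 𝕋(K^p) → E` the semisimple
  `ρ_λ : G_{ℚ,S} → GL₂(E)` "whose determinant is `λ ∘ D_S`".  §7.2.1 (p. 117): "Let `ρ` be as in
  Theorem 7.1.2 and `λ' : 𝕋(K^p) → E` such that `ρ_{λ'} ≅ ρ`. The classicality part of
  Theorem 7.1.2 is equivalent with saying that `M_{k+1}(K^p) ⊗_{ℚ_p} E[λ'] ≠ 0`. Let
  `λ : 𝕋(K^p) → E` be the twist of `λ'` by the cyclotomic character, i.e. `λ(T_l) = l⁻¹λ'(T_l)`,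
  `l ∉ S`. Then `ρ_λ(-1) ≅ ρ` and `H̃¹(K^p, E)[λ] = H̃¹(K^p, E)[ρ]`"; §5.5.5 (p. 75):
  "`M_k(K^p) = … = colim_{K_p} H⁰(X_{K^pK_p}, ω^k)` denotes the space of classical holomorphic
  modular forms of weight `k`".
* L. Pan, *On locally analytic vectors of the completed cohomology of modular curves*, Forum
  Math. Pi 10 (2022) = arXiv:2008.07099 (doi:10.1017/fmp.2022.1) [Pan2022LocallyAnalytic].
  §1: "Let `p` be a rational prime."  §6.1.1: `𝕋(K^pK_p) ⊂ End_{ℤ_p}(H¹_ét(𝒴_{K^pK_p}, ℤ_p))`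
  (open curves), `𝕋(K^p) := lim 𝕋(K^pK_p)`, "It acts faithfully on `H̃¹(K^p, ℤ_p)`", same `D_S` and
  `ρ_λ` ("an odd semi-simple Galois representation (unique up to conjugation) … whose
  determinant is `λ ∘ D_S`").
  **Definition 6.1.2**: "We say `ρ` is • pro-modular if there exists a tame level `K^p` and
  `λ : 𝕋(K^p) → ℚ̄_p` such that `ρ ≅ ρ_λ`; • pro-cohomological if
  `Hom_{G_ℚ}(ρ(-1), H̃¹(K^p, ℚ̄_p)) ≠ 0` for some tame level `K^p`."  **Corollary 6.3.6**:
  "Suppose `ρ = ρ_λ` is pro-modular and irreducible for some tame level `K^p`. Then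
  `H̃¹(K^p, ℚ̄_p)[𝔭_λ] ≠ 0`, i.e. `ρ` is pro-cohomological" (from Thm. 6.3.5, local–global
  compatibility of the two `R^{ps}`-actions on `H̃¹(K^p, E/𝒪)_{ζ',𝔪}`, and Thm. 6.3.3 =
  Paškūnas–Tung).  This "pro-modular" is Emerton's "promodular" [Emerton2011LocalGlobal, §1.2:
  "isomorphic to the Galois representation attached to a cuspidal `p`-adic modular eigenform of
  some (possibly non-integral) weight, or equivalently … in the Zariski closure … of … classical
  cuspforms"; Prop. 6.1.12].
* V. Paškūnas, S.-N. Tung, *Finiteness properties of the category of mod `p` representations of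
  `GL₂(ℚ_p)`*, Forum Math. Sigma 9 (2021) e80 [PaskunasTung2021].  Abstract: "We treat all the
  remaining open cases, which occur when `p` is `2` or `3`. Our arguments carry over for all
  primes `p`. This allows us to remove the restrictions on the residual representation at `p` in
  Lue Pan's recent proof".  **Theorem 7.1** (`R` local, acting faithfully and compatibly with
  `R^{ps} → Z_𝔅` on an `𝒪`-torsion free `M ∈ ℭ(𝒪)_𝔅` finitely generated over `R⟦K⟧`;
  `x : R → ℚ̄_p`): "Then under the above assumptions `Π(M)[𝔪_x]` is non-zero and is of finite
  length", and §7, before Thm. 7.3: "The result allows to remove the restrictions imposed on the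
  Galois representation `ρ̄_{𝔪,p}` in [Pan], by taking `M` to be the Pontryagin dual of …
  `H̃¹(K^p, E/𝒪)_{𝔪,ζ'}` … Since [Pan] is the only place, where the restriction on `p` is used, the
  proof of [Pan] goes through without a change".  So Cor. 6.3.6 — hence hypothesis (1) of
  Thm. 1.1.2 for every pro-modular absolutely irreducible `ρ` — holds at EVERY prime, `p = 2`
  included; neither paper of Pan imposes a parity condition on `p` outside the pro-MODULARITY
  theorem (Forum Pi) 6.4.8 (`p > 2`, quoted from Emerton), which is not used here.

## Rendering in the tree's vocabulary (read before reviewing)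

(a) **"pro-modular"** is `∃ 𝒰 : BigHeckeGLn.TameLevel 2 ℚ p, 𝒰.IsPadicallyAutomorphic ρ`: `ρ` is
ASSOCIATED (unramified at `v ∉ S` with `charpoly ρ(Frob_v) = X² - x(T_{v,1}) X + q_v x(T_{v,2})`,
arithmetic Frobenius, `heckeFrobPoly`) with a CONTINUOUS `ℚ̄_p`-point `x` of the tree's
completed-cohomology Hecke algebra `𝕋(K^p) = CompletedCohomologyHeckeAlgebraGLn 𝒰` (closure of the
spherical algebra in `∏_{(r,s,i)} End H^i(X_{U_r}, ℤ/p^s)`, ALL degrees `i`, `X_U` = Scholze's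
quotients, i.e. group cohomology of `GL₂(ℚ)` in `Fun(GL₂(𝔸^∞)/U, ℤ/p^s)`) — TOGETHER WITH
`ρ.IsResiduallyAbsIrreducible`.  This is the typing of "pro-modular" of the accepted route
statements `SkinnerWilesDefectOne.ProModularOrdinaryClassical` and
`EisensteinGelfandKirillov.CrystallineProModularClassical`.  Dictionary with Pan's points
`λ : 𝕋(K^p) → ℚ̄_p` (Def. 6.1.2) — not printed in this form, routine, and recorded so that every
step is visible: `x(𝕋(K^p))` is a compact subring of `ℚ̄_p`, hence inside some `𝒪_E`, `E/ℚ_p`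
finite; the residual eigensystem `x mod 𝔪_E` has an open maximal kernel `𝔪` whose residual
representation is `ρ̄^{ss}`, absolutely irreducible by hypothesis (`𝔪` is non-Eisenstein).  As
`U` is open in `GL₂(ℤ̂)`, the levels of the `p`-power tower are `U_r = Γ(p^r) · K^p`
(`Γ(p^r) = 1 + p^r M₂(ℤ_p)`) for all `r ≥ r₀` and ONE tame level `K^p ⊂ GL₂(𝔸_f^p)` (shrink it to
a product `∏_{l≠p} K_l`, which only restricts eigensystems along `𝕋(K'^p) ↠ 𝕋(K^p)`); for
`r ≥ max(r₀, 2)` the groups `GL₂(ℚ) ∩ g U_r g⁻¹` are torsion-free with determinant `1`, so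
`X_{U_r}` is a union of components of the modular curve `Y_{K^pΓ(p^r)}` (the complement being
their complex conjugates),
`H^i(X_{U_r}, ℤ/p^s) = 0` for `i ≥ 2`, and pull-back embeds `H¹(X_{U_r}, ℤ/p^s)` Hecke-equivariantly
in `H¹(Y_{K^pΓ(p^r)}, ℤ_p) ⊗ ℤ/p^s` (Hecke operators on group cohomology are the double-coset
correspondences, [cite: GeeNewton2020, §2.1.1]; Ash–Stevens 1986, §1); after localisation at the
non-Eisenstein `𝔪` every other factor (`r < max(r₀,2)` or `i ≠ 1`) is
`H^{i-1}(U_r/U_{r'}, H¹(X_{U_{r'}}, ℤ/p^s)_𝔪)` by the Hecke-equivariant Hochschild–Serre spectral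
sequence of `U_{r'} ⊲ U_r` ([cite: CalegariEmerton2011, Thm. 1.1 (4) and §1.8]; `H⁰_𝔪 = 0`, the
eigensystems of `H⁰` being `T_l ↦ (l+1)ψ(l)`, `S_l ↦ ψ(l)²`, which are reducible).  Hence the
abstract spherical algebra acts on a faithful module of the `𝔪`-part of the tree's `𝕋(K^p)`
through Pan's `𝕋(K^p)`, which is compact with dense image there, so surjects onto it: `x` IS a
point `λ` of Pan's `𝕋(K^p)`, and `ρ_λ ≅ ρ ⊗ ψ`, where the character `ψ` absorbs the
normalisations (Pan:
`det(X - D_S(Frob_l)) = X² - l⁻¹T_l X + l⁻¹S_l`; tree: arithmetic Frobenius and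
`X² - T_v X + q_v S_v`; the two differ by duality, the central character `l ↦ x(S_l)` and a
cyclotomic twist, so `ψ = ε_p^j χ₀` with `χ₀` of finite order unramified outside `S`, because `ρ`,
hence `det ρ`, is de Rham).  `ρ ⊗ ψ` is irreducible, so Cor. 6.3.6 makes it pro-cohomological —
hypothesis (1) of Thm. 1.1.2 for `ρ ⊗ ψ(-1)`.

(b) **"de Rham of Hodge–Tate weights `0, k`, `k > 0`"**: the typed clause is de Rham-ness of
`ρ|_{Γ_{ℚ_p}}` for Fontaine's PINNED datum (`(fontainePstAdicCompletion v p hv).IsDeRhamFramed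
(ρ.toLocal v)`, genuine de Rham-ness) with multiplicity-free labelled Hodge–Tate weights
(`(ρ.labelledHodgeTateWeightsAt v … τ).Nodup`; for `v = (p)` there is exactly one continuous
`τ : ℚ_p → ℚ̄_p`, so this is ONE multiset of two distinct integers `a < b`) — VERBATIM the clause of
`XZhang2024_fontaineMazurGL2_tateTwist` and of the consumer route.  The Tate twist `ε_p^{∓a}` moves
`{a, b}` to `{0, k}`, `k = b - a > 0`, and preserves hypothesis (1) (cup product with the
invertible `t^a ∈ H̃⁰(K^p, ℤ_p)`, on which `G_ℚ` acts through `ε_p`: [Pan2022LocallyAnalytic],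
proof of Thm. 6.4.7; [Pan2022LocallyAnalyticII], §7.2.1).

(c) **"arises from a cuspidal eigenform of weight `k + 1`"** = `M_{k+1}(K^p) ⊗_{ℚ_p} E[λ'] ≠ 0`
with `ρ_{λ'} ≅` the twisted `ρ` (§7.2.1): a holomorphic `T_l, S_l`-eigenform (`l ∉ S`) of weight
`k + 1 ≥ 2` with eigensystem `λ'`, not Eisenstein (`ρ_{λ'}` is irreducible), hence a cuspidal
eigenform with that eigensystem and its NEWFORM `f` (Atkin–Lehner; the Galois representation of an
eigenform is that of its newform, Deligne 1971); `ρ_{f,ι_f} ≅` the twisted `ρ` by Chebotarev and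
Brauer–Nesbitt, up to the normalisation of `ρ_{λ'}` against Deligne's `ρ_f` (a Tate twist);
undoing `ψ = ε_p^j χ₀` replaces `f` by the newform of `f ⊗ χ₀⁻¹` (Atkin–Li 1978, §3).  Net
statement: SOME TATE TWIST `ρ ⊗ ε_p^m`, `m ∈ ℤ`, is attached to a newform `f ∈ S_k(Γ₁(N))` away
from `N p` — in the classical rendering of the tree, `IsGaloisRepOfNewform1 f ι_f {q ∣ N p} (ρ ⊗ χ)`
(unramified at `q ∤ N p` with `charpoly (ρ ⊗ χ)(Frob_q) = ι_f(X² - a_q(f) X + ε_f(q) q^{k-1})`,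
arithmetic Frobenius, Deligne–Serre's normalisation) with `χ(σ) = ε_p(σ)^m`,
`ε_p = cyclotomicPadicAlgCl ℚ p` — EXACTLY the conclusion of
`XZhang2024_fontaineMazurGL2_tateTwist`.

(d) The hypotheses `ρ.toGaloisRep.IsIrreducible` and "unramified at all but finitely many `v`" are
implied by the others (residual absolute irreducibility; association outside the finite `S`,
cf. [Pan2022LocallyAnalyticII, Remark 1.1.4]) and are kept only to match the consumer's registered
stub verbatim — extra hypotheses weaken a fact.  `p` is ANY prime ("Fix a prime number `p`").

## What is NOT here

No discharge (irreducibly XL: Pan's geometric Sen and Fontaine operators on `𝒪^{la}_{K^p}` over the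
flag variety, the Paškūnas–Tung Bernstein-centre theorem, Colmez–Dospinescu–Paškūnas); the
finiteness part (2) of Thm. 7.1.2 and the description of `H̃¹[ρ]^{la}` (§7.3); Emerton's
local–global compatibility; any PRO-MODULARITY theorem ([Emerton2011LocalGlobal] Thm. 1.2.3 and
[Pan2022LocallyAnalytic] Thm. 6.4.8 need `p > 2` and a generic `ρ̄`; at `p = 2` the pro-modularity
of a given `ρ` is the open crux of the consumer) — pro-modularity is a HYPOTHESIS of this fact; the
residually REDUCIBLE case (Cor. 6.3.6 allows Eisenstein `𝔪`, but the comparison (a) of the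
all-degree Hecke algebra with the degree-one algebra is asserted only after non-Eisenstein
localisation); the irregular case (`a = b`, weight one: [Pan2022LocallyAnalytic] Thm. 6.4.7);
`F ≠ ℚ`; local–global compatibility at `q ∣ N p` (only the a.e. dictionary is rendered, as in
`FontaineMazurGL2OddPrime`).

## What IS proved in the tree around this fact (index; theorems only, all accepted)

Rendering (a), as bookkeeping for ANY number field `K`, rank `n`, prime `p` and tame level `𝒰`
(files `Literature/NumberTheory/Automorphic/…`, namespace `BigHeckeGLn.TameLevel`):
* `HeckePointValuesFiniteExtension` — the generator relations of `𝕋(K^p)` (`heckeT_zero`,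
  `heckeT_eq_of_le`, `isUnit_heckeT`), and "`x(𝕋(K^p)) ⊆ 𝒪_E`, `E/ℚ_p` finite": a continuous
  `x : 𝕋(K^p) → ℚ̄_p` associated with some `ρ` takes values in a FINITE subextension
  (`IsAssociated.exists_intermediateField_forall_apply_mem`,
  `IsPadicallyAutomorphic.exists_intermediateField`; no Baire argument — a finite `ℚ_p`-model of
  `ρ` and the density of the spherical algebra);
* `PadicallyAutomorphicResidualEigensystem` — continuous points are integral (`norm_apply_le_one`,
  `exists_integralPoint`), the residual eigensystem is continuous for the discrete topology
  (`continuous_residue_comp`), reductions of `ρ` are associated with it (`IsAssociated.reduction`),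
  and `IsPadicallyAutomorphic ρ` with `ρ.IsResiduallyAbsIrreducible` yield an open prime
  NON-EISENSTEIN `𝔪` with `IsPointOver`, `IsResidualRepAt`
  (`IsPadicallyAutomorphic.exists_isNonEisenstein`), MAXIMAL by
  `PadicallyAutomorphicResidualEigensystemMaximal`
  (`IsPadicallyAutomorphic.exists_isMaximal_isNonEisenstein`) — "the residual eigensystem has an
  open maximal non-Eisenstein kernel `𝔪`";
* `PadicallyAutomorphicDetComplexConjugation` (`K = ℚ`) — `det ρ(c) = (-1)^{n(n-1)/2}` for every
  complex conjugation `c` and every `p`-adically automorphic `ρ`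
  (`IsPadicallyAutomorphic.coe_det_apply_of_isComplexConjugation`); for `n = 2`,
  `IsPadicallyAutomorphic.isOdd` — Pan's "`ρ_λ` … an odd … Galois representation" (§6.1.1) in the
  tree's model, without Chebotarev.
Rendering (b): the sections `TateTwistHypotheses` and `TateTwistNormalisation` below, with
`Literature/NumberTheory/GaloisRepresentations/LabelledWeightsTateTwist` (`HT_τ` of a Tate twist is
shifted by `-j`), `…/LabelledWeightsDeRhamRank` (`card HT_τ(ρ) = n` for de Rham `ρ`; in rank `2`,
`Nodup` gives `{a, b}`, `a < b`) and
`Literature/NumberTheory/PAdicHodge/CyclotomicPowersLabelledWeightsBdR` (`HT_τ(1) = {0}^n` for the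
pin): BOTH sides of "WLOG Hodge–Tate weights `0, k`" (§7.2.1) are proved.
Reductions of the statement to EXISTING named facts (files `ProModularDeRhamClassicalGL2QOddPrime`,
`ProModularDeRhamClassicalGL2QDyadicResidual`, using
`Literature/NumberTheory/GaloisRepresentations/ResidualRepScalarExtension`):
* `p ≠ 2`: `proModularDeRhamClassical_GL2Q_of_ne_two` — the statement at odd `p` follows from
  `XZhang2024_fontaineMazurGL2_tateTwist` (oddness supplied by `IsPadicallyAutomorphic.isOdd`);
* `p = 2`, `ρ̄` of NON-solvable image: `proModularDeRhamClassical_GL2Q_two_of_not_isSolvable` — from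
  `Tung2020_fontaineMazurGL2_two_tateTwist` and `exists_newform_of_odd_irreducible (p := 2)`;
* hence `Pan2022_proModularDeRhamClassical_GL2Q_iff_dyadic_solvable` (with the one-line glues
  `Pan2022_proModularDeRhamClassical_GL2Q.of_dyadic` and
  `Pan2022_proModularDeRhamClassical_GL2Q.of_dyadic_solvable`): granted those three facts, the
  statement is EQUIVALENT to its instance
  `p = 2`, `ρ̄` absolutely irreducible with SOLVABLE (dihedral) image — the case of the consumer
  crux.  Off the two printed dihedral cells (`Allen2014_modularity_nearlyOrdinaryDihedral_Q`,
  `Thorne2026_fontaineMazurGL2_potCrystallineOrdinary`, which conclude without pro-modularity) that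
  instance is in print ONLY as Thm. 1.1.2 + Cor. 6.3.6 + Paškūnas–Tung Thm. 7.1, and it is the
  irreducible XL content: Emerton's `H̃¹(K^p)` as a `(GL₂(ℚ_p) × G_ℚ)`-module, Cor. 6.3.6 and
  Thm. 7.1.2 have no counterpart in the tree.
Rendering (c), PROVED (file `ProModularDeRhamClassicalGL2QEigenform`, over
`Literature/NumberTheory/EllipticCurves/NewformGaloisRepOfEigenformProofs` and
`…/HeckeRingCharacterEigenformProofs`), granted as a hypothesis the EXISTING named fact
`Hida2000_thm326_exists_galoisRep` (Deligne's theorem at EVERY `p`-adic embedding; the tree's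
one-place `exists_padicGaloisRep_of_isNewform1` would not suffice, the embedding `K_f → ℚ̄_p` being
forced by the Frobenius traces of `ρ`):
* `newformTateTwist_of_eigenform_tateTwist` — if a Tate twist `ρ ⊗ ε_p^j` of an irreducible `ρ`
  carries, at all but finitely many places, the packet of a non-zero cuspidal eigenform of weight
  `k ≥ 2` and level `Γ₁(M)` (read through any `ι : ℚ̄_p ≃ ℂ`), the conclusion of the fact holds for
  `ρ` (Atkin–Lehner–Li `exists_isNewform1_of_eigenpacket`, Hida's fact at `ι`, Chebotarev +
  Brauer–Nesbitt `FramedGaloisRep.nonempty_equiv_of_hasFrobCharpolyAt_eventually`, and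
  `newformTateTwist_of_tateTwist`);
* `newformTateTwist_of_heckeEigensystem_tateTwist` — the same from a `p`-ADIC Hecke eigensystem
  `θ : 𝕋_ℤ(M, k) → ℚ̄_p` of the Hecke ring of `S_k(Γ₁(M))` (`heckeRing1`;
  `charpoly (ρ ⊗ ε_p^j)(Frob_q) = X² - θ(T_q) X + q^{k-1} θ(⟨q⟩)` almost everywhere), every character
  of `𝕋_ℤ` being the eigencharacter of an eigenform (Hida 2000, Thm. 3.17 / §3.2.1, proved from
  Shimura's duality and Deligne–Serre (2.7.2));
* hence `Pan2022_proModularDeRhamClassical_GL2Q.of_heckeEigensystem[_dyadic_solvable]`: the fact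
  follows from `Hida2000_thm326_exists_galoisRep` and the statement "for every `ρ` with the
  hypotheses of the fact (at `p = 2` with dihedral `ρ̄` suffices), the `p`-adic Hecke eigensystem of
  some Tate twist of `ρ` occurs in `S_k(Γ₁(M))` for some `M` and `k ≥ 2`" — Thm. 1.1.2 (1) with
  Cor. 6.3.6 / Paškūnas–Tung Thm. 7.1 read literally (§7.2.1: `M_{k+1}(K^p) ⊗ E[λ'] ≠ 0`), displayed
  there as a binder: THAT statement is the irreducible unproved content.
NOT proved: of rendering (a), the comparison "continuous point of the all-degree algebra ⟹ point
of Pan's degree-one `𝕋(K^p)`" (`H⁰`-eigensystems Eisenstein, `H^i(X_{U_r}, ℤ/p^s) = 0` for `i ≥ 2`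
at torsion-free level, Hecke-equivariant Hochschild–Serre), the twist-stability of
`IsPadicallyAutomorphic` (not needed by the glue above, which twists on the output side), and the
dictionary between Pan's level `K^p K_p` and `Γ₁(M)`.

## References

* L. Pan, *On locally analytic vectors of the completed cohomology of modular curves II*,
  arXiv:2209.06366 (2022), §1.1.1, Thm. 1.1.2, Remark 1.1.4, §5.5.5, §7.1.1, Thm. 7.1.2, §7.1.4,
  §7.2.1. [Pan2022LocallyAnalyticII]
* L. Pan, Forum Math. Pi 10 (2022) = arXiv:2008.07099, §1, §6.1.1, Def. 6.1.2, Lemma 6.1.3,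
  Thm. 6.3.3, Thm. 6.3.5, Cor. 6.3.6, Thm. 6.4.7, Thm. 6.4.8. [Pan2022LocallyAnalytic]
* V. Paškūnas, S.-N. Tung, Forum Math. Sigma 9 (2021) e80 = arXiv:2104.08948, Abstract, Thm. 1.3,
  Thm. 7.1, §7 (before Thm. 7.3). [PaskunasTung2021]
* M. Emerton, *Local-global compatibility in the `p`-adic Langlands programme for `GL₂/ℚ`* (2011),
  §1.2, Thm. 1.2.3, Prop. 6.1.12. [Emerton2011LocalGlobal]
* F. Calegari, M. Emerton, *Completed cohomology — a survey* (2011), Thm. 1.1 (4), §1.5, §1.8.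
  [CalegariEmerton2011]
* T. Gee, J. Newton, *Patching and the completed homology of locally symmetric spaces* (2020),
  §2.1.1. [GeeNewton2020]  P. Scholze, Ann. of Math. 182 (2015), §V.4. [Scholze2015]
* A. Ash, G. Stevens, J. reine angew. Math. 365 (1986), §1. [AshStevensCrelle1986]
* A. O. L. Atkin, W. Li, Invent. Math. 48 (1978), §3. [AtkinLi1978]
* P. Deligne, Sém. Bourbaki 355 (1971). [Deligne1971Bourbaki355]  P. Deligne, J.-P. Serre,
  Ann. Sci. ÉNS 7 (1974), Thm. 6.1 (normalisation of `ρ_{f,λ}`). [DeligneSerreASENS1974]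
* X. Zhang, arXiv:2412.06812 (2024), Thm. 1.0.2 (the odd-prime companion fact).
  [XZhang2024FontaineMazurP3]
-/

noncomputable section

open scoped MatrixGroups Matrix NumberField ModularForm
open NumberField IsDedekindDomain Field Filter CongruenceSubgroup

namespace Literature.NumberTheory.Automorphic

open Literature.NumberTheory.GaloisRepresentations
open Literature.NumberTheory.EllipticCurves.ModularForms

/-- **Pan, arXiv:2209.06366, Thm. 1.1.2 (= Thm. 7.1.2), with Pan, Forum Math. Pi 10 (2022),
Def. 6.1.2 and Cor. 6.3.6, and Paškūnas–Tung 2021, Thm. 7.1: a pro-modular, regular de Rham,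
residually absolutely irreducible `ρ : Γ_ℚ → GL₂(ℚ̄_p)` is classical — at EVERY prime `p`
(`p = 2` included), rendering with a TATE twist** (module docstring for the printed statements
and the rendering decisions (a)–(d)).  Let `p` be ANY prime and `ρ : Γ_ℚ → GL₂(ℚ̄_p)` continuous
such that: some reduction `ρ̄` of `ρ` is absolutely irreducible; `ρ` is irreducible and unramified
at all but finitely many places; `ρ|_{Γ_{ℚ_p}}` is de Rham (Fontaine's pinned datum
`fontainePstAdicCompletion`) with distinct labelled Hodge–Tate weights; and `ρ` is `p`-adically
automorphic of some tame level — associated (arithmetic Frobenius,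
`charpoly ρ(Frob_v) = X² - x(T_{v,1}) X + q_v x(T_{v,2})` for `v ∉ S`) with a continuous
`ℚ̄_p`-valued point `x` of the completed-cohomology Hecke algebra of `GL₂/ℚ`
(`BigHeckeGLn.TameLevel.IsPadicallyAutomorphic`; "pro-modular", Pan's Def. 6.1.2, Emerton's
"promodular").  Then "`ρ` arises from a cuspidal eigenform" (Pan: pro-modular and irreducible ⟹
`Hom_{G_ℚ}(ρ(-1), H̃¹(K^p, ℚ̄_p)) ≠ 0`, Cor. 6.3.6, valid at every `p` by Paškūnas–Tung Thm. 7.1;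
then Thm. 1.1.2 for the Tate twist with Hodge–Tate weights `0, k`, `k > 0`), i.e. some Tate twist
of `ρ` is the Galois representation of a newform: there are a continuous character
`χ : Γ_ℚ → ℚ̄_pˣ` with `χ(σ) = ε_p(σ)^m` for an integer `m` (`ε_p = cyclotomicPadicAlgCl ℚ p`), a
newform `f ∈ S_k(Γ₁(N))` and an embedding `ι_f : K_f → ℚ̄_p` of its coefficient field such that
`ρ ⊗ χ` is attached to `f` away from `N p` — unramified at every prime `q ∤ N p` with
`charpoly (ρ ⊗ χ)(Frob_q) = ι_f(X² - a_q(f) X + ε_f(q) q^{k-1})` (arithmetic Frobenius).  Same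
hypothesis clauses and VERBATIM the conclusion of `XZhang2024_fontaineMazurGL2_tateTwist`, with
"`p ≠ 2`, `ρ` odd" replaced by "`ρ̄` absolutely irreducible, `ρ` `p`-adically automorphic".  Named
fact (D-0014); users take `(h : Pan2022_proModularDeRhamClassical_GL2Q)`.
[cite: Pan2022LocallyAnalyticII, Thm. 1.1.2 (= Thm. 7.1.2, p. 116 of arXiv:2209.06366) with §7.1.4 and §7.2.1 (p. 117)]
[cite: Pan2022LocallyAnalytic, Def. 6.1.2 and Cor. 6.3.6 (§6.1.1, §6.3 of arXiv:2008.07099)]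
[cite: PaskunasTung2021, Thm. 7.1 and §7 (paragraph before Thm. 7.3)]
[cite: DeligneSerreASENS1974, Thm. 6.1] -/
def Pan2022_proModularDeRhamClassical_GL2Q : Prop :=
  ∀ (p : ℕ) [Fact p.Prime] (ρ : FramedGaloisRep ℚ (PadicAlgCl p) 2),
    ρ.IsResiduallyAbsIrreducible → ρ.toGaloisRep.IsIrreducible →
    (∀ᶠ v : HeightOneSpectrum (𝓞 ℚ) in cofinite, ρ.IsUnramifiedAt v) →
    (∀ (v : HeightOneSpectrum (𝓞 ℚ)) (hv : ((p : ℕ) : 𝓞 ℚ) ∈ v.asIdeal),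
      (PAdicHodge.fontainePstAdicCompletion v p hv).IsDeRhamFramed (ρ.toLocal v) ∧
      ∀ τ : v.adicCompletion ℚ →+* PadicAlgCl p, Continuous τ →
        (ρ.labelledHodgeTateWeightsAt v (PAdicHodge.fontainePstAdicCompletion v p hv).algebra
          (PAdicHodge.fontainePstAdicCompletion v p hv).𝔅 τ).Nodup) →
    (∃ 𝒰 : BigHeckeGLn.TameLevel 2 ℚ p, 𝒰.IsPadicallyAutomorphic ρ) →
    ∃ (χ : absoluteGaloisGroup ℚ →ₜ* (PadicAlgCl p)ˣ) (m : ℤ),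
      (∀ σ, χ σ = cyclotomicPadicAlgCl ℚ p σ ^ m) ∧
      ∃ (N : ℕ) (_ : NeZero N) (k : ℤ) (f : CuspForm (Gamma1 N) k)
        (ιf : coeffCharField f →+* PadicAlgCl p),
        IsNewform1 f ∧ IsGaloisRepOfNewform1 f ιf {q | q ∣ N * p} (FramedRep.twist ρ χ)

/-! ### The normalisation step of the printed proof: the conclusion is blind to Tate twists

[cite: Pan2022LocallyAnalyticII, §7.2.1 (p. 117)]: "Let `λ : 𝕋(K^p) → E` be the twist of `λ'` by
the cyclotomic character … Then `ρ_λ(-1) ≅ ρ`" — the proof of Thm. 7.1.2 is run for the Tate twist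
of `ρ` whose Hodge–Tate weights are `0, k` (rendering (b) of the module docstring), and the
eigenform found for that twist is the one asserted for `ρ`.  In the tree's rendering this is the
following PROVED bookkeeping: the conclusion "some Tate twist `ρ ⊗ ε_p^m` is attached to a newform
away from `N p`" holds for `ρ` as soon as it holds for any one Tate twist `ρ ⊗ ε_p^j` of `ρ`,
because `(ρ ⊗ χ₀) ⊗ χ = ρ ⊗ (χ χ₀)` (`FramedRep.twist_twist`) and `ε_p^m ε_p^j = ε_p^{m+j}`.  The
conclusion shape is VERBATIM that of `Pan2022_proModularDeRhamClassical_GL2Q` and of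
`XZhang2024_fontaineMazurGL2_tateTwist`, so the lemma serves both. -/

/-- **Tate-twist invariance of the conclusion of `Pan2022_proModularDeRhamClassical_GL2Q`** (the
normalisation step "replace `ρ` by the Tate twist with Hodge–Tate weights `0, k`" of the printed
proof): if `χ₀ = ε_p^j` pointwise and some Tate twist of `ρ ⊗ χ₀` is the Galois representation of a
newform `f` away from `N p` (twisting character `ε_p^m`), then so is some Tate twist of `ρ` — the
same `f`, `ι_f`, `N`, `k`, with twisting character `χ χ₀ = ε_p^{m+j}`.
[cite: Pan2022LocallyAnalyticII, §7.2.1 (p. 117 of arXiv:2209.06366: "Let λ be the twist of λ' by the cyclotomic character … ρ_λ(-1) ≅ ρ")] -/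
theorem newformTateTwist_of_tateTwist {p : ℕ} [Fact p.Prime]
    (ρ : FramedGaloisRep ℚ (PadicAlgCl p) 2) {χ₀ : absoluteGaloisGroup ℚ →ₜ* (PadicAlgCl p)ˣ} {j : ℤ}
    (hχ₀ : ∀ σ, χ₀ σ = cyclotomicPadicAlgCl ℚ p σ ^ j)
    (h : ∃ (χ : absoluteGaloisGroup ℚ →ₜ* (PadicAlgCl p)ˣ) (m : ℤ),
      (∀ σ, χ σ = cyclotomicPadicAlgCl ℚ p σ ^ m) ∧
      ∃ (N : ℕ) (_ : NeZero N) (k : ℤ) (f : CuspForm (Gamma1 N) k)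
        (ιf : coeffCharField f →+* PadicAlgCl p),
        IsNewform1 f ∧
          IsGaloisRepOfNewform1 f ιf {q | q ∣ N * p} (FramedRep.twist (FramedRep.twist ρ χ₀) χ)) :
    ∃ (χ : absoluteGaloisGroup ℚ →ₜ* (PadicAlgCl p)ˣ) (m : ℤ),
      (∀ σ, χ σ = cyclotomicPadicAlgCl ℚ p σ ^ m) ∧
      ∃ (N : ℕ) (_ : NeZero N) (k : ℤ) (f : CuspForm (Gamma1 N) k)
        (ιf : coeffCharField f →+* PadicAlgCl p),
        IsNewform1 f ∧ IsGaloisRepOfNewform1 f ιf {q | q ∣ N * p} (FramedRep.twist ρ χ) := by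
  obtain ⟨χ, m, hχ, N, hN, k, f, ιf, hf, hρ⟩ := h
  refine ⟨χ * χ₀, m + j, fun σ => ?_, N, hN, k, f, ιf, hf, ?_⟩
  · rw [ContinuousMonoidHom.mul_apply, hχ σ, hχ₀ σ, zpow_add]
  · rwa [FramedRep.twist_twist] at hρ

/-- The same bookkeeping read in the direction the glue uses it: **to prove the conclusion of
`Pan2022_proModularDeRhamClassical_GL2Q` for `ρ` it suffices to prove it for ONE Tate twist
`ρ ⊗ ε_p^j`** (`j ∈ ℤ` arbitrary; such a twisting character exists,
`exists_cyclotomicCharacter_padicAlgCl_zpow`).  With `j = -a` for labelled Hodge–Tate weights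
`{a, b}`, `a < b`, this is the reduction to weights `{0, k}`, `k = b - a > 0`, of §7.2.1.
[cite: Pan2022LocallyAnalyticII, §7.2.1 (p. 117)] -/
theorem newformTateTwist_of_forall_tateTwist {p : ℕ} [Fact p.Prime]
    (ρ : FramedGaloisRep ℚ (PadicAlgCl p) 2) (j : ℤ)
    (h : ∀ χ₀ : absoluteGaloisGroup ℚ →ₜ* (PadicAlgCl p)ˣ,
      (∀ σ, χ₀ σ = cyclotomicPadicAlgCl ℚ p σ ^ j) →
      ∃ (χ : absoluteGaloisGroup ℚ →ₜ* (PadicAlgCl p)ˣ) (m : ℤ),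
        (∀ σ, χ σ = cyclotomicPadicAlgCl ℚ p σ ^ m) ∧
        ∃ (N : ℕ) (_ : NeZero N) (k : ℤ) (f : CuspForm (Gamma1 N) k)
          (ιf : coeffCharField f →+* PadicAlgCl p),
          IsNewform1 f ∧
            IsGaloisRepOfNewform1 f ιf {q | q ∣ N * p} (FramedRep.twist (FramedRep.twist ρ χ₀) χ)) :
    ∃ (χ : absoluteGaloisGroup ℚ →ₜ* (PadicAlgCl p)ˣ) (m : ℤ),
      (∀ σ, χ σ = cyclotomicPadicAlgCl ℚ p σ ^ m) ∧
      ∃ (N : ℕ) (_ : NeZero N) (k : ℤ) (f : CuspForm (Gamma1 N) k)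
        (ιf : coeffCharField f →+* PadicAlgCl p),
        IsNewform1 f ∧ IsGaloisRepOfNewform1 f ιf {q | q ∣ N * p} (FramedRep.twist ρ χ) := by
  -- `χ₀ := ε_p^j`, built as `zpowGroupHom j ∘ ε_p` (continuous: `continuous_zpow`), so that
  -- `χ₀ σ = ε_p(σ)^j` holds by `rfl` (as in `exists_cyclotomicCharacter_padicAlgCl_zpow`).
  let χ₀ : absoluteGaloisGroup ℚ →ₜ* (PadicAlgCl p)ˣ :=
    { toMonoidHom := (zpowGroupHom j).comp (cyclotomicPadicAlgCl ℚ p).toMonoidHom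
      continuous_toFun := (continuous_zpow j).comp (cyclotomicPadicAlgCl ℚ p).continuous }
  have hχ₀ : ∀ σ, χ₀ σ = cyclotomicPadicAlgCl ℚ p σ ^ j := fun _ => rfl
  exact newformTateTwist_of_tateTwist ρ hχ₀ (h χ₀ hχ₀)

/-! ### The normalisation step, hypotheses side: the local clauses are blind to Tate twists

Rendering (b) of the module docstring ("The Tate twist `ε_p^{∓a}` moves `{a, b}` to `{0, k}`,
`k = b - a > 0`"), i.e. the other half of the reduction "WLOG `ρ|_{G_{ℚ_p}}` has Hodge–Tate
weights `0, k`" of [cite: Pan2022LocallyAnalyticII, §7.2.1 (p. 117)], as PROVED bookkeeping for a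
Tate twist `ρ ⊗ χ`, `χ = ε_p^m` (`m ∈ ℤ`), of any `ρ : Γ_K →ₜ* GL_n(ℚ̄_p)` over a number field `K`:

* `ρ ⊗ χ` is again unramified at all but finitely many places (`ε_p` is unramified away from `p`;
  accepted `FramedGaloisRep.isUnramifiedAt_twist`, `eq_one_of_mem_inertia_of_cyclotomic_zpow`);
* at every `v ∣ p`, `(ρ ⊗ χ)|_{Γ_{K_v}}` is de Rham for THE pinned datum as soon as `ρ|_{Γ_{K_v}}`
  is (accepted `fontainePstAdicCompletion_isDeRhamFramed_tateTwist_of_isDeRhamFramed`,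
  unconditional since the period ring of the pin IS `B_dR(K_v)`), and its `τ`-labelled
  Hodge–Tate weights are those of `ρ` moved by `-m` (accepted
  `FramedGaloisRep.labelledHodgeTateWeightsAt_twist_of_cyclotomic_zpow`: `HT_τ(W(m)) = HT_τ(W) - m`,
  [cite: FontaineAsterisque223III, Exp. III Prop. 1.5.2], [cite: BarnetlambEtAl2014, Introduction
  (Notation)]), so "de Rham with distinct labelled weights above `p`" — VERBATIM the local clause
  of `Pan2022_proModularDeRhamClassical_GL2Q` and of `XZhang2024_fontaineMazurGL2_tateTwist` — holds
  for `ρ ⊗ χ` iff it holds for `ρ` (`deRhamDistinctWeights_twist_of_cyclotomic_zpow`).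

(Irreducibility is likewise twist-invariant — accepted `FramedRep.isIrreducible_of_twist` — and the
conclusion is blind to Tate twists by `newformTateTwist_of_tateTwist` above; what is NOT proved
here is the twist-stability of the remaining two hypotheses, residual absolute irreducibility and
`p`-adic automorphy `BigHeckeGLn.TameLevel.IsPadicallyAutomorphic`, the latter being the cup
product with `ε_p mod p^s ∘ det` on completed cohomology, [cite: Pan2022LocallyAnalytic, §6.2].)
The bridge from the global character `χ = ε_p^m` (`ε_p = cyclotomicPadicAlgCl K p`, values in
`ℚ̄_pˣ`) to the local cyclotomic character of `K_v` used by the `PAdicHodge` files is the accepted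
`cyclotomicCharacter_absGaloisRestrict`. -/

section TateTwistHypotheses

variable {K : Type} [Field K] [NumberField K] {p : ℕ} [Fact p.Prime] {n : ℕ}

omit [NumberField K] in
/-- `χ = ε_p^m` in the convention of `TateTwistFrobeniusProofs` / `PstWeilDeligneTateTwist`:
`χ(σ) = (χ_p(σ))^m` in `ℚ̄_p`, `χ_p` the `ℤ_pˣ`-valued cyclotomic character of `K`. [folklore] -/
theorem coe_apply_of_cyclotomicPadicAlgCl_zpow {χ : absoluteGaloisGroup K →ₜ* (PadicAlgCl p)ˣ}
    {m : ℤ} (hχ : ∀ σ, χ σ = cyclotomicPadicAlgCl K p σ ^ m) (σ : absoluteGaloisGroup K) :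
    (χ σ : PadicAlgCl p) =
      (algebraMap ℚ_[p] (PadicAlgCl p)
        ((GaloisRep.cyclotomicCharacter K p σ : ℤ_[p]ˣ) : ℤ_[p])) ^ m := by
  rw [hχ, Units.val_zpow_eq_zpow_val, coe_cyclotomicPadicAlgCl_apply]

/-- **`ε_p^m` restricted to a decomposition group `Γ_{K_v}` is the `m`-th power of the cyclotomic
character of `K_v`** (accepted `cyclotomicCharacter_absGaloisRestrict`).
[cite: SerreAbelianLadic1968, Ch. I §1.2] -/
theorem coe_apply_absGaloisRestrict_of_cyclotomicPadicAlgCl_zpow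
    {χ : absoluteGaloisGroup K →ₜ* (PadicAlgCl p)ˣ} {m : ℤ}
    (hχ : ∀ σ, χ σ = cyclotomicPadicAlgCl K p σ ^ m) (v : HeightOneSpectrum (𝓞 K))
    (σ : absoluteGaloisGroup (v.adicCompletion K)) :
    (χ (absGaloisRestrict K (v.adicCompletion K) σ) : PadicAlgCl p) =
      (algebraMap ℚ_[p] (PadicAlgCl p)
        ((GaloisRep.cyclotomicCharacter (v.adicCompletion K) p σ : ℤ_[p]ˣ) : ℤ_[p])) ^ m := by
  haveI : NeZero ((p : ℕ) : K) := ⟨Nat.cast_ne_zero.2 (Fact.out : p.Prime).ne_zero⟩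
  rw [coe_apply_of_cyclotomicPadicAlgCl_zpow hχ, cyclotomicCharacter_absGaloisRestrict]

/-- **A Tate twist of an almost everywhere unramified `ρ` is almost everywhere unramified**
(`ε_p^m` is trivial on inertia at every `v ∤ p`, and the places above `p` are finitely many).
[cite: SerreAbelianLadic1968, Ch. I §1.2 and §2.1] -/
theorem eventually_isUnramifiedAt_twist_of_cyclotomicPadicAlgCl_zpow
    {ρ : FramedGaloisRep K (PadicAlgCl p) n}
    (hρ : ∀ᶠ v : HeightOneSpectrum (𝓞 K) in cofinite, ρ.IsUnramifiedAt v)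
    {χ : absoluteGaloisGroup K →ₜ* (PadicAlgCl p)ˣ} {m : ℤ}
    (hχ : ∀ σ, χ σ = cyclotomicPadicAlgCl K p σ ^ m) :
    ∀ᶠ v : HeightOneSpectrum (𝓞 K) in cofinite,
      FramedGaloisRep.IsUnramifiedAt v (FramedRep.twist ρ χ) := by
  have hfin : {v : HeightOneSpectrum (𝓞 K) | ((p : ℕ) : 𝓞 K) ∈ v.asIdeal}.Finite := by
    have hne : (Ideal.span {((p : ℕ) : 𝓞 K)} : Ideal (𝓞 K)) ≠ ⊥ := by
      rw [Ne, Ideal.span_singleton_eq_bot, Nat.cast_eq_zero]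
      exact (Fact.out : p.Prime).ne_zero
    refine (Ideal.finite_factors hne).subset fun v hv => ?_
    simp only [Set.mem_setOf_eq] at hv ⊢
    exact (Ideal.dvd_span_singleton).mpr hv
  filter_upwards [hρ, hfin.eventually_cofinite_notMem] with v hv hvp
  exact FramedGaloisRep.isUnramifiedAt_twist hv fun 𝔓 h𝔓 σ hσ =>
    eq_one_of_mem_inertia_of_cyclotomic_zpow (coe_apply_of_cyclotomicPadicAlgCl_zpow hχ) hvp h𝔓 hσ

/-- **A Tate twist of a representation de Rham at `v ∣ p` is de Rham at `v`** (THE pinned datum,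
unconditionally; accepted `fontainePstAdicCompletion_isDeRhamFramed_tateTwist_of_isDeRhamFramed`).
[cite: FontaineAsterisque223III, Exp. III Prop. 1.5.2] -/
theorem isDeRhamFramed_toLocal_twist_of_cyclotomicPadicAlgCl_zpow
    (ρ : FramedGaloisRep K (PadicAlgCl p) n) {χ : absoluteGaloisGroup K →ₜ* (PadicAlgCl p)ˣ} {m : ℤ}
    (hχ : ∀ σ, χ σ = cyclotomicPadicAlgCl K p σ ^ m) (v : HeightOneSpectrum (𝓞 K))
    (hv : ((p : ℕ) : 𝓞 K) ∈ v.asIdeal)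
    (hρ : (PAdicHodge.fontainePstAdicCompletion v p hv).IsDeRhamFramed (ρ.toLocal v)) :
    (PAdicHodge.fontainePstAdicCompletion v p hv).IsDeRhamFramed
      (FramedGaloisRep.toLocal v (FramedRep.twist ρ χ)) :=
  PAdicHodge.fontainePstAdicCompletion_isDeRhamFramed_tateTwist_of_isDeRhamFramed v hv hρ m
    (χ.comp (absGaloisRestrict K (v.adicCompletion K)))
    (coe_apply_absGaloisRestrict_of_cyclotomicPadicAlgCl_zpow hχ v)

/-- **A Tate twist moves the labelled Hodge–Tate weights at `v ∣ p` by `-m`**: for THE pinned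
datum and every label `τ : K_v → ℚ̄_p`,
`HT_τ((ρ ⊗ ε_p^m)|_{Γ_{K_v}}) = HT_τ(ρ|_{Γ_{K_v}}) - m` (accepted
`FramedGaloisRep.labelledHodgeTateWeightsAt_twist_of_cyclotomic_zpow`).
[cite: FontaineAsterisque223III, Exp. III Prop. 1.5.2] [cite: BarnetlambEtAl2014, Introduction (Notation)]
[cite: Pan2022LocallyAnalyticII, §7.2.1 (p. 117)] -/
theorem labelledHodgeTateWeightsAt_twist_of_cyclotomicPadicAlgCl_zpow
    (ρ : FramedGaloisRep K (PadicAlgCl p) n) {χ : absoluteGaloisGroup K →ₜ* (PadicAlgCl p)ˣ} {m : ℤ}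
    (hχ : ∀ σ, χ σ = cyclotomicPadicAlgCl K p σ ^ m) (v : HeightOneSpectrum (𝓞 K))
    (hv : ((p : ℕ) : 𝓞 K) ∈ v.asIdeal) (τ : v.adicCompletion K →+* PadicAlgCl p) :
    FramedGaloisRep.labelledHodgeTateWeightsAt (FramedRep.twist ρ χ) v
        (PAdicHodge.fontainePstAdicCompletion v p hv).algebra
        (PAdicHodge.fontainePstAdicCompletion v p hv).𝔅 τ =
      (ρ.labelledHodgeTateWeightsAt v (PAdicHodge.fontainePstAdicCompletion v p hv).algebra
        (PAdicHodge.fontainePstAdicCompletion v p hv).𝔅 τ).map (fun i => i - m) :=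
  ρ.labelledHodgeTateWeightsAt_twist_of_cyclotomic_zpow χ m v hv
    (coe_apply_absGaloisRestrict_of_cyclotomicPadicAlgCl_zpow hχ v) τ

/-- **The local clause "de Rham at every `v ∣ p` with distinct labelled Hodge–Tate weights at
every continuous label" is invariant under Tate twists** — VERBATIM the clause of
`Pan2022_proModularDeRhamClassical_GL2Q` (and of `XZhang2024_fontaineMazurGL2_tateTwist`), for any
number field and any rank: it holds for `ρ ⊗ ε_p^m` as soon as it holds for `ρ` (and conversely,
twisting back by `ε_p^{-m}`, `FramedRep.twist_twist_inv`).  This is the hypotheses side of the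
normalisation "WLOG Hodge–Tate weights `0, k`" of the printed proof.
[cite: Pan2022LocallyAnalyticII, §7.2.1 (p. 117)] [cite: FontaineAsterisque223III, Exp. III Prop. 1.5.2] -/
theorem deRhamDistinctWeights_twist_of_cyclotomicPadicAlgCl_zpow
    (ρ : FramedGaloisRep K (PadicAlgCl p) n) {χ : absoluteGaloisGroup K →ₜ* (PadicAlgCl p)ˣ} {m : ℤ}
    (hχ : ∀ σ, χ σ = cyclotomicPadicAlgCl K p σ ^ m)
    (h : ∀ (v : HeightOneSpectrum (𝓞 K)) (hv : ((p : ℕ) : 𝓞 K) ∈ v.asIdeal),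
      (PAdicHodge.fontainePstAdicCompletion v p hv).IsDeRhamFramed (ρ.toLocal v) ∧
      ∀ τ : v.adicCompletion K →+* PadicAlgCl p, Continuous τ →
        (ρ.labelledHodgeTateWeightsAt v (PAdicHodge.fontainePstAdicCompletion v p hv).algebra
          (PAdicHodge.fontainePstAdicCompletion v p hv).𝔅 τ).Nodup) :
    ∀ (v : HeightOneSpectrum (𝓞 K)) (hv : ((p : ℕ) : 𝓞 K) ∈ v.asIdeal),
      (PAdicHodge.fontainePstAdicCompletion v p hv).IsDeRhamFramed
          (FramedGaloisRep.toLocal v (FramedRep.twist ρ χ)) ∧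
      ∀ τ : v.adicCompletion K →+* PadicAlgCl p, Continuous τ →
        (FramedGaloisRep.labelledHodgeTateWeightsAt (FramedRep.twist ρ χ) v
          (PAdicHodge.fontainePstAdicCompletion v p hv).algebra
          (PAdicHodge.fontainePstAdicCompletion v p hv).𝔅 τ).Nodup := fun v hv =>
  ⟨isDeRhamFramed_toLocal_twist_of_cyclotomicPadicAlgCl_zpow ρ hχ v hv (h v hv).1, fun τ hτ =>
    (ρ.labelledHodgeTateWeightsAt_twist_nodup_iff_of_cyclotomic_zpow χ m v hv
      (coe_apply_absGaloisRestrict_of_cyclotomicPadicAlgCl_zpow hχ v) τ).2 ((h v hv).2 τ hτ)⟩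

end TateTwistHypotheses

/-! ### The normalisation step, hypotheses side (concluded): weights `a < b`, and the Tate twist
with weights `0, k`, `k > 0`

[cite: Pan2022LocallyAnalyticII, Thm. 1.1.2 (2) and §7.2.1 (p. 117)]: hypothesis (2) of Thm. 1.1.2 is
"`ρ|_{G_{ℚ_p}}` is de Rham of Hodge–Tate weights `0, k` for some integer `k > 0`", reached in §7.2.1
from distinct weights by a Tate twist.  In rendering (b) of the module docstring the local clause of
`Pan2022_proModularDeRhamClassical_GL2Q` is "de Rham for THE pinned datum with multiplicity-free
labelled weights at every continuous label".  By the accepted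
`FramedGaloisRep.card_labelledHodgeTateWeightsAt_eq_of_isDeRhamFramed` (file
`LabelledWeightsDeRhamRank`: a de Rham `ρ : Γ_K →ₜ* GL_n(ℚ̄_p)` has exactly `n` labelled Hodge–Tate
weights at every continuous label `τ : K_v →+* ℚ̄_p`, unconditionally for the pin) a rank-two `ρ`
satisfying that clause has labelled weights `{a, b}` with `a < b` at each `(v, τ)`, and its Tate twist
`ρ ⊗ ε_p^a` has labelled weights `{0, k}`, `k = b - a > 0`, there
(`labelledHodgeTateWeightsAt_twist_of_cyclotomicPadicAlgCl_zpow` above).  PROVED bookkeeping, for any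
number field `K` and any place `v ∣ p`; for `K = ℚ` there is one place above `p` and one continuous
label `ℚ_p → ℚ̄_p`, so this is literally hypothesis (2) of the printed theorem for the twist, which
keeps every other hypothesis (`deRhamDistinctWeights_twist_of_cyclotomicPadicAlgCl_zpow`,
`eventually_isUnramifiedAt_twist_of_cyclotomicPadicAlgCl_zpow`, accepted
`FramedRep.isIrreducible_of_twist`) and does not change the conclusion
(`newformTateTwist_of_tateTwist`). -/

section TateTwistNormalisation

variable {K : Type} [Field K] [NumberField K] {p : ℕ} [Fact p.Prime]

omit [NumberField K] in
/-- **The `m`-th power of the `p`-adic cyclotomic character as a continuous `ℚ̄_pˣ`-valued character**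
(`zpowGroupHom m ∘ ε_p`, so that `χ(σ) = ε_p(σ)^m` holds by `rfl`). [folklore] -/
theorem exists_character_eq_cyclotomicPadicAlgCl_zpow (m : ℤ) :
    ∃ χ : absoluteGaloisGroup K →ₜ* (PadicAlgCl p)ˣ, ∀ σ, χ σ = cyclotomicPadicAlgCl K p σ ^ m :=
  ⟨{ toMonoidHom := (zpowGroupHom m).comp (cyclotomicPadicAlgCl K p).toMonoidHom
     continuous_toFun := (continuous_zpow m).comp (cyclotomicPadicAlgCl K p).continuous },
    fun _ => rfl⟩

/-- **Under the local clause of `Pan2022_proModularDeRhamClassical_GL2Q` a rank-two `ρ` has labelled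
Hodge–Tate weights `{a, b}` with `a < b`** at every place `v ∣ p` and every continuous label
`τ : K_v →+* ℚ̄_p` (accepted `FramedGaloisRep.exists_labelledHodgeTateWeightsAt_eq_pair`: de Rham of
rank `2` ⟹ exactly two labelled weights; multiplicity-free ⟹ distinct).
[cite: Pan2022LocallyAnalyticII, Thm. 1.1.2 (2)] [cite: Patrikis2019, §2.7.1] -/
theorem exists_labelledHodgeTateWeightsAt_eq_pair_of_localClause (ρ : FramedGaloisRep K (PadicAlgCl p) 2)
    (h : ∀ (v : HeightOneSpectrum (𝓞 K)) (hv : ((p : ℕ) : 𝓞 K) ∈ v.asIdeal),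
      (PAdicHodge.fontainePstAdicCompletion v p hv).IsDeRhamFramed (ρ.toLocal v) ∧
      ∀ τ : v.adicCompletion K →+* PadicAlgCl p, Continuous τ →
        (ρ.labelledHodgeTateWeightsAt v (PAdicHodge.fontainePstAdicCompletion v p hv).algebra
          (PAdicHodge.fontainePstAdicCompletion v p hv).𝔅 τ).Nodup)
    (v : HeightOneSpectrum (𝓞 K)) (hv : ((p : ℕ) : 𝓞 K) ∈ v.asIdeal)
    (τ : v.adicCompletion K →+* PadicAlgCl p) (hτ : Continuous τ) :
    ∃ a b : ℤ, a < b ∧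
      ρ.labelledHodgeTateWeightsAt v (PAdicHodge.fontainePstAdicCompletion v p hv).algebra
        (PAdicHodge.fontainePstAdicCompletion v p hv).𝔅 τ = {a, b} :=
  ρ.exists_labelledHodgeTateWeightsAt_eq_pair v hv (h v hv).1 τ hτ ((h v hv).2 τ hτ)

/-- **The Tate twist `ρ ⊗ ε_p^a` moves labelled weights `{a, b}` to `{0, b - a}`** (accepted shift
`labelledHodgeTateWeightsAt_twist_of_cyclotomicPadicAlgCl_zpow`: `HT_τ(ρ ⊗ ε_p^a) = HT_τ(ρ) - a`).
[cite: Pan2022LocallyAnalyticII, §7.2.1 (p. 117)] [cite: FontaineAsterisque223III, Exp. III Prop. 1.5.2] -/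
theorem labelledHodgeTateWeightsAt_twist_eq_zero_sub {n : ℕ} (ρ : FramedGaloisRep K (PadicAlgCl p) n)
    {χ : absoluteGaloisGroup K →ₜ* (PadicAlgCl p)ˣ} {a b : ℤ}
    (hχ : ∀ σ, χ σ = cyclotomicPadicAlgCl K p σ ^ a) (v : HeightOneSpectrum (𝓞 K))
    (hv : ((p : ℕ) : 𝓞 K) ∈ v.asIdeal) (τ : v.adicCompletion K →+* PadicAlgCl p)
    (hHT : ρ.labelledHodgeTateWeightsAt v (PAdicHodge.fontainePstAdicCompletion v p hv).algebra
      (PAdicHodge.fontainePstAdicCompletion v p hv).𝔅 τ = {a, b}) :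
    FramedGaloisRep.labelledHodgeTateWeightsAt (FramedRep.twist ρ χ) v
        (PAdicHodge.fontainePstAdicCompletion v p hv).algebra
        (PAdicHodge.fontainePstAdicCompletion v p hv).𝔅 τ = {0, b - a} := by
  rw [labelledHodgeTateWeightsAt_twist_of_cyclotomicPadicAlgCl_zpow ρ hχ v hv τ, hHT,
    Multiset.insert_eq_cons, Multiset.map_cons, Multiset.map_singleton, sub_self, Multiset.insert_eq_cons]

/-- **Hypothesis (2) of Pan's Thm. 1.1.2 after the Tate twist of §7.2.1.**  Under the local clause of
`Pan2022_proModularDeRhamClassical_GL2Q` (de Rham for THE pinned datum with multiplicity-free labelled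
weights at every continuous label), for every place `v ∣ p` and continuous label `τ : K_v →+* ℚ̄_p`
there are an integer `m` and a Tate twist `ρ ⊗ ε_p^m` of `ρ` whose `τ`-labelled Hodge–Tate weights at
`v` are `{0, k}` with `k > 0` — "de Rham of Hodge–Tate weights `0, k` for some integer `k > 0`".  For
`K = ℚ` (one place above `p`, one continuous label) this is literally hypothesis (2) for the twist,
which keeps the remaining hypotheses and the conclusion of the named fact (module docstring of this
section).  PROVED bookkeeping; the named fact itself is not discharged here.
[cite: Pan2022LocallyAnalyticII, Thm. 1.1.2 (2) and §7.2.1 (p. 117)] -/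
theorem exists_tateTwist_labelledHodgeTateWeightsAt_eq_zero_pos (ρ : FramedGaloisRep K (PadicAlgCl p) 2)
    (h : ∀ (v : HeightOneSpectrum (𝓞 K)) (hv : ((p : ℕ) : 𝓞 K) ∈ v.asIdeal),
      (PAdicHodge.fontainePstAdicCompletion v p hv).IsDeRhamFramed (ρ.toLocal v) ∧
      ∀ τ : v.adicCompletion K →+* PadicAlgCl p, Continuous τ →
        (ρ.labelledHodgeTateWeightsAt v (PAdicHodge.fontainePstAdicCompletion v p hv).algebra
          (PAdicHodge.fontainePstAdicCompletion v p hv).𝔅 τ).Nodup)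
    (v : HeightOneSpectrum (𝓞 K)) (hv : ((p : ℕ) : 𝓞 K) ∈ v.asIdeal)
    (τ : v.adicCompletion K →+* PadicAlgCl p) (hτ : Continuous τ) :
    ∃ (χ : absoluteGaloisGroup K →ₜ* (PadicAlgCl p)ˣ) (m : ℤ),
      (∀ σ, χ σ = cyclotomicPadicAlgCl K p σ ^ m) ∧
      ∃ k : ℤ, 0 < k ∧
        FramedGaloisRep.labelledHodgeTateWeightsAt (FramedRep.twist ρ χ) v
            (PAdicHodge.fontainePstAdicCompletion v p hv).algebra
            (PAdicHodge.fontainePstAdicCompletion v p hv).𝔅 τ = {0, k} := by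
  obtain ⟨a, b, hab, hHT⟩ := exists_labelledHodgeTateWeightsAt_eq_pair_of_localClause ρ h v hv τ hτ
  obtain ⟨χ, hχ⟩ := exists_character_eq_cyclotomicPadicAlgCl_zpow (K := K) (p := p) a
  exact ⟨χ, a, hχ, b - a, sub_pos.2 hab, labelledHodgeTateWeightsAt_twist_eq_zero_sub ρ hχ v hv τ hHT⟩

end TateTwistNormalisation

end Literature.NumberTheory.Automorphic

end
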